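import Summits.QuantumFields.BalabanUV.Beta.EriceRemainderEnclosureHistoryAutonomyComparisonPerron
import Summits.QuantumFields.BalabanUV.Beta.EriceRemainderEnclosureHistoryAutonomyEnd

/-!
# EriceRemainderEnclosureHistoryAutonomyComparisonEnd — (E49g) THE ENDs OF THE COMPARISON STATION: under node U2's binder list at the SHARP CLOSED constant
# for ONE history family `β` (`InjectedRate`, `ScaleShiftRate`, `HistLipschitz Λ` with rows `Σ_i Λ k i ≤ M`, `EventualLowerH b`, `M·γ ≤ 3√3·b` — (E37c) ∕
# (E38d) ∕ (E48e)'s list VERBATIM) PLUS ONE displayed sign hypothesis — every `β k` is NON-INCREASING IN THE OLDER COUPLINGS at frozen newest coupling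
# (equivalently, on the limit functional: `betaInf β` is antitone in the older couplings) — and a SECOND history family `βt ≥ β` on every box (with its own
# `ScaleShiftRate` ∕ `HistLipschitz`, NOTHING else), the continuum running couplings of ANY two lattice families `g` (runs of `β`) and `gt` (runs of `βt`)
# pinned at the SAME infrared value satisfy `gstar gt m ≤ gstar g m` at EVERY physical scale: a pointwise larger lattice β-function family gives a pointwise
# smaller continuum running coupling — by (E49c)'s Perron comparison, the newest coupling entering with any sign

Cell `pub-balaban`, β-function sub-cell, BINDER row D4 «RemainderConst leaves for Bałaban's split» (`HOME/BINDER-OWNERS.md`; owner lineage `b2b-balaban-beta-an4`;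
this file by co-owner #2 lineage `b2b-balaban-beta-d4-p2`, generation 46), β-FLOW TEAM duty (1), FREEZE (0) honoured (def-free; node U2's `betaInf` ∕ `revHist` ∕
`tendsto_betaInf` ∕ `le_betaInf_of_eventualLower` ∕ `tendsto_invSq`, (E37a)'s `memFlow_gstar_of_injectedRate` ∕ `seqBox_gstar_of_tendsto`, (E37c)'s
`zerothMoment_betaInf_of_rows` ∕ `rowBound_nonneg`, (E49c)'s `le_of_functional_le_zs_closed` BY NAME, nothing restated; the binder lists are HYPOTHESES — NOT
PRINTED (GAPS G-t4-U2-1∕-2), never facts).  Sequel of (E49c) `…HistoryAutonomyComparisonPerron`; parallel to (E48e) `…HistoryAutonomyOrderEnd` (order in the PIN).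

HONEST FRAMING (page 1, verbatim and binding).  *"Discharging BetaPertH makes Bałaban's UV stability UNCONDITIONAL — a real constructive-QFT result; it is
NOT the continuum limit and NOT the Clay problem."*  THIS FILE DISCHARGES NOTHING OF THE KIND.  It composes [folklore] real analysis over node U2's typed
HYPOTHESIS SHAPES on ABSTRACT families `β, βt : FlowStep.HBeta`; the sign hypothesis (antitone in the older couplings) and the order `β ≤ βt` are displayed
binders about abstract families — which sign Bałaban's `β_k` of [I] (1.22) has in the preceding couplings is NOT PRINTED ([I] p. 298: the dependence
exists, qualitatively) and not asserted.  Row D4 class UNCHANGED (critical-path width 0; instance 0∕1; D4 DISCHARGE NO DATE).  HONEST DEPENDENCY: continuum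
YM on T⁴ ⇐ BetaPertH ∧ nine spine estimates (0/9 proved); BetaPertH ⇐ (D1) ∧ (D4) ∧ CAP+tail; G-an2-4 gates asym, D1 and NE2/3/4.

WHAT IS PROVED ([folklore]; 0 `def`, 0 sorry).  §1 **`betaInf_le_betaInf_of_le`** (lattice order `β k ≤ βt k` on the boxes ⟹ `betaInf β ≤ betaInf βt` on the
box-valued histories), **`tailAntitone_betaInf_of_lattice`** (every `β k` non-increasing in the older entries at frozen newest entry ⟹
`betaInf β` antitone in the older couplings).  §2 **`gstar_le_gstar_of_betaInf_le_rows_closed`** (the END with the sign and the order displayed on the LIMIT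
functionals), **`gstar_le_gstar_of_lattice_le_rows_closed`** (the same with both read off LATTICE data: `β k ≤ βt k` and `β k` antitone in the older entries).
-/

noncomputable section
open Filter Topology Finset Set

namespace Summit.QuantumFields.BalabanUV.Beta.EriceRemainderEnclosureHistoryAutonomyComparisonEnd

open Literature.MathematicalPhysics.QuantumFieldTheory.Balaban1983to89
open Literature.MathematicalPhysics.QuantumFieldTheory.Balaban1983to89.FlowStep
open Literature.MathematicalPhysics.QuantumFieldTheory.Balaban1983to89.T4CouplingMatching
open Literature.MathematicalPhysics.QuantumFieldTheory.Balaban1983to89.T4CauchySum (InjectedRate)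
open Literature.MathematicalPhysics.QuantumFieldTheory.Balaban1983to89.T4ContinuumCoupling
open Literature.MathematicalPhysics.QuantumFieldTheory.Balaban1983to89.T4BetaStationary
open Literature.MathematicalPhysics.QuantumFieldTheory.Balaban1983to89.T4BetaFlowWellPosed (MemFlow)
open Summit.QuantumFields.BalabanUV.Beta.EriceRemainderEnclosureHistoryAutonomy
open Summit.QuantumFields.BalabanUV.Beta.EriceRemainderEnclosureHistoryAutonomyEnd
open Summit.QuantumFields.BalabanUV.Beta.EriceRemainderEnclosureHistoryAutonomyComparisonPerron (le_of_functional_le_zs_closed)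

variable {β βt : HBeta} {γ c θs ct θst : ℝ} {Λ Λt : ℕ → ℕ → ℝ} {M : ℝ}
variable {g gt : ℕ → ℕ → ℝ} {gIR C θ₁ Ct θt b : ℝ} {k₀ : ℕ}

/-! ## §1 Order and sign of the limit functionals, read off lattice data -/

/-- **LATTICE ORDER PASSES TO THE LIMIT FUNCTIONALS**: `β k v ≤ βt k v` on every box ⟹ `betaInf β u ≤ betaInf βt u` on the box-valued histories (both
families with `ScaleShiftRate`, each its own constants, for the limits to exist). [folklore] -/
theorem betaInf_le_betaInf_of_le (hss : ScaleShiftRate c θs γ β) (hθs1 : θs < 1) (hsst : ScaleShiftRate ct θst γ βt) (hθst1 : θst < 1)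
    (hle : ∀ k v, v ∈ Box γ k → β k v ≤ βt k v) {u : ℕ → ℝ} (hu : SeqBox γ u) : betaInf β u ≤ betaInf βt u :=
  le_of_tendsto_of_tendsto' (tendsto_betaInf hss hθs1 hu) (tendsto_betaInf hsst hθst1 hu) fun k => hle k _ (revHist_mem_box hu k)

/-- **ANTITONE LATTICE MEMORY PASSES TO THE LIMIT FUNCTIONAL**: every `β k` NON-INCREASING IN THE OLDER ENTRIES at frozen newest entry (`v (last) =
v′ (last)`, `v ≤ v′` ⟹ `β k v′ ≤ β k v`) ⟹ `betaInf β` is antitone in the older couplings — (E49c)'s sign hypothesis. [folklore] -/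
theorem tailAntitone_betaInf_of_lattice (hss : ScaleShiftRate c θs γ β) (hθs1 : θs < 1)
    (hanti : ∀ k (v v' : Fin (k + 1) → ℝ), v ∈ Box γ k → v' ∈ Box γ k → v (Fin.last k) = v' (Fin.last k) → (∀ i, v i ≤ v' i) →
      β k v' ≤ β k v) :
    ∀ u u' : ℕ → ℝ, SeqBox γ u → SeqBox γ u' → u 0 = u' 0 → (∀ j, u (j + 1) ≤ u' (j + 1)) → betaInf β u' ≤ betaInf β u := by
  intro u u' hu hu' h0 htl
  refine le_of_tendsto_of_tendsto' (tendsto_betaInf hss hθs1 hu') (tendsto_betaInf hss hθs1 hu) fun k => ?_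
  refine hanti k _ _ (revHist_mem_box hu k) (revHist_mem_box hu' k) (by rw [revHist_last, revHist_last, h0]) fun i => ?_
  rcases eq_or_ne i (Fin.last k) with rfl | hi
  · rw [revHist_last, revHist_last, h0]
  · have hik : (i : ℕ) < k := Fin.val_lt_last hi
    have e : k - (i : ℕ) = (k - i - 1) + 1 := by omega
    rw [revHist_apply, revHist_apply, e]
    exact htl _

/-! ## §2 The ENDs: a larger lattice β-family gives a smaller continuum running coupling -/

/-- **COMPARISON OF CONTINUUM RUNNING COUPLINGS — SIGN AND ORDER ON THE LIMIT FUNCTIONALS.**  `β` under node U2's binder list at the sharp CLOSED constant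
(`ScaleShiftRate c θs γ β`, `HistLipschitz Λ γ β` with `Λ ≥ 0` and rows `Σ_{i≤k} Λ k i ≤ M`, `EventualLowerH b γ k₀ β` with `b > 0`, `M·γ ≤ 3√3·b`) PLUS
`betaInf β` NON-INCREASING IN THE OLDER COUPLINGS; `βt` with `ScaleShiftRate ct θst γ βt`, `HistLipschitz Λt γ βt` (ANY `Λt`) and `betaInf β ≤ betaInf βt` on
the box; lattice families `g` (runs of `β`, `InjectedRate C 0 θ₁`) and `gt` (runs of `βt`, `InjectedRate Ct 0 θt`) in the box, BOTH pinned at `g_IR`.  Then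
`gstar gt m ≤ gstar g m` at EVERY physical scale `m`.  Binders NOT PRINTED, never facts ((0.20) p. 256 ∕ (0.31) p. 259 of [I] are quoted in the headers of
`FlowStep` ∕ `T4CouplingMatching` only). [folklore] -/
theorem gstar_le_gstar_of_betaInf_le_rows_closed (hθ1 : θ₁ < 1) (hinj : InjectedRate C 0 θ₁ (fun K j => disc (g K) (g (K + 1)) j))
    (hbox : ∀ K i, i ≤ K → 0 < g K i ∧ g K i ≤ γ) (hrun : ∀ K, RGEqH K β (g K)) (hpin : ∀ K, g K K = gIR)
    (hθt1 : θt < 1) (hinjt : InjectedRate Ct 0 θt (fun K j => disc (gt K) (gt (K + 1)) j))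
    (hboxt : ∀ K i, i ≤ K → 0 < gt K i ∧ gt K i ≤ γ) (hrunt : ∀ K, RGEqH K βt (gt K)) (hpint : ∀ K, gt K K = gIR)
    (hss : ScaleShiftRate c θs γ β) (hL : HistLipschitz Λ γ β) (hΛ : ∀ k i, i ≤ k → 0 ≤ Λ k i)
    (hrow : ∀ k, ∑ i ∈ range (k + 1), Λ k i ≤ M) (hθs0 : 0 ≤ θs) (hθs1 : θs < 1) (hev : EventualLowerH b γ k₀ β)
    (hb : 0 < b) (hsmall : M * γ ≤ 3 * Real.sqrt 3 * b)
    (htail : ∀ u u' : ℕ → ℝ, SeqBox γ u → SeqBox γ u' → u 0 = u' 0 → (∀ j, u (j + 1) ≤ u' (j + 1)) → betaInf β u' ≤ betaInf β u)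
    (hsst : ScaleShiftRate ct θst γ βt) (hLt : HistLipschitz Λt γ βt) (hθst0 : 0 ≤ θst) (hθst1 : θst < 1)
    (hle : ∀ u, SeqBox γ u → betaInf β u ≤ betaInf βt u) (m : ℕ) : gstar gt m ≤ gstar g m := by
  have hgIR : 0 < gIR := by rw [← hpin 0]; exact (hbox 0 0 le_rfl).1
  have hgIRγ : gIR ≤ γ := by rw [← hpin 0]; exact (hbox 0 0 le_rfl).2
  have hconv : ∀ m, Tendsto (invSq g m) atTop (𝓝 (astar g m)) := fun m => tendsto_invSq hθ1 hinj m
  have hconvt : ∀ m, Tendsto (invSq gt m) atTop (𝓝 (astar gt m)) := fun m => tendsto_invSq hθt1 hinjt m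
  exact le_of_functional_le_zs_closed htail (zerothMoment_betaInf_of_rows hss hθs1 hL hΛ hrow) (rowBound_nonneg hΛ hrow) hgIR hgIRγ hb
    (fun u hu => le_betaInf_of_eventualLower hss hθs1 hev hu) hsmall hle le_rfl (seqBox_gstar_of_tendsto hbox hconv)
    (memFlow_gstar_of_injectedRate hθ1 hinj hbox hrun hpin hss hL hθs0 hθs1) (seqBox_gstar_of_tendsto hboxt hconvt)
    (memFlow_gstar_of_injectedRate hθt1 hinjt hboxt hrunt hpint hsst hLt hθst0 hθst1) m

/-- **COMPARISON OF CONTINUUM RUNNING COUPLINGS — SIGN AND ORDER READ OFF LATTICE DATA**: the same with `betaInf β ≤ betaInf βt` replaced by `β k v ≤ βt k v`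
on every box and the sign hypothesis by «every `β k` is non-increasing in the older entries at frozen newest entry» (§1). [folklore] -/
theorem gstar_le_gstar_of_lattice_le_rows_closed (hθ1 : θ₁ < 1) (hinj : InjectedRate C 0 θ₁ (fun K j => disc (g K) (g (K + 1)) j))
    (hbox : ∀ K i, i ≤ K → 0 < g K i ∧ g K i ≤ γ) (hrun : ∀ K, RGEqH K β (g K)) (hpin : ∀ K, g K K = gIR)
    (hθt1 : θt < 1) (hinjt : InjectedRate Ct 0 θt (fun K j => disc (gt K) (gt (K + 1)) j))
    (hboxt : ∀ K i, i ≤ K → 0 < gt K i ∧ gt K i ≤ γ) (hrunt : ∀ K, RGEqH K βt (gt K)) (hpint : ∀ K, gt K K = gIR)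
    (hss : ScaleShiftRate c θs γ β) (hL : HistLipschitz Λ γ β) (hΛ : ∀ k i, i ≤ k → 0 ≤ Λ k i)
    (hrow : ∀ k, ∑ i ∈ range (k + 1), Λ k i ≤ M) (hθs0 : 0 ≤ θs) (hθs1 : θs < 1) (hev : EventualLowerH b γ k₀ β)
    (hb : 0 < b) (hsmall : M * γ ≤ 3 * Real.sqrt 3 * b)
    (hanti : ∀ k (v v' : Fin (k + 1) → ℝ), v ∈ Box γ k → v' ∈ Box γ k → v (Fin.last k) = v' (Fin.last k) → (∀ i, v i ≤ v' i) →
      β k v' ≤ β k v)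
    (hsst : ScaleShiftRate ct θst γ βt) (hLt : HistLipschitz Λt γ βt) (hθst0 : 0 ≤ θst) (hθst1 : θst < 1)
    (hlat : ∀ k v, v ∈ Box γ k → β k v ≤ βt k v) (m : ℕ) : gstar gt m ≤ gstar g m :=
  gstar_le_gstar_of_betaInf_le_rows_closed hθ1 hinj hbox hrun hpin hθt1 hinjt hboxt hrunt hpint hss hL hΛ hrow hθs0 hθs1 hev hb hsmall
    (tailAntitone_betaInf_of_lattice hss hθs1 hanti) hsst hLt hθst0 hθst1
    (fun _ hu => betaInf_le_betaInf_of_le hss hθs1 hsst hθst1 hlat hu) m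

end Summit.QuantumFields.BalabanUV.Beta.EriceRemainderEnclosureHistoryAutonomyComparisonEnd

end
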